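import Summits.BirchSwinnertonDyer.Rank1Residual.Supersingular.SignedTwistedZeroSet
import HarnessLib

/-!
# The BUDGET form of the zero count: given the known vanishing conductors `S₀` and a finite exact
# check at the conductors the remaining budget `λ − r − Σ_{S₀} φ` can still afford, NO OTHER conductor
# carries a vanishing twist — the kernel shape of the gen-8 vanishing-conductor census
# (cell `b2b-bsdres`; prover unit `b2b-bsdres-additive-p3`, gen 8)

HONEST FRAMING (run/shared/lean/b2b/bsd-rank1-residual/, verbatim in every file): the goal of the
cell is to DELETE the COMBINATION-SHAPED residual classes of the Birch–Swinnerton-Dyer formula for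
ALL analytic-rank `≤ 1` elliptic curves over `ℚ` — "full BSD formula for every rank `≤ 1` curve in
class `C`" assembled STRICTLY from published theorems — so that the rank-`≤ 1` remainder becomes
exactly the CONSTRUCTION-SHAPED classes, which are TYPED (missing-input `Prop`s), NOT attempted.
This is not "finishing BSD". THEOREMS ONLY; no named fact (Kato's Cor. 14.3 (2) appears only as the
displayed hypothesis `hK` of the tower statement); nothing about any curve is asserted; nothing
booked; no label changes.

## What this file proves

The census `HOME/b2b-bsdres-additive-p3/g8/VANISHING-CONDUCTORS.md` reads iw-2's two-engine
certificates (`λ`, and the exact list `CZ` of layers `n` whose Mazur–Tate element is divisible by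
`Φ_{pⁿ⁺¹}(1+T)`, i.e. whose conductor-`p^{n+1+e₀}` Birch sums all vanish) through the gen-8 theorems.
This file is the kernel statement the census instantiates per row:

* `forall_ratTwistedSymbolSum_ne_zero_of_budget` (`p`-adic side; twisted interpolation clause `hI`
  for `(f, α)`, `α ≠ 0`, integral model `ι(G) = ϖ·L`, `T^r ∣ G ≠ 0`): let `S₀` be a finite set of
  layers each carrying a vanishing Birch sum, and suppose that for every layer `n ∉ S₀` which the
  budget can still afford (`r + Σ_{m∈S₀} φ(p^{m+1}) + φ(pⁿ⁺¹) ≤ λ(G)`) SOME primitive even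
  `p`-power-order `χ₀` of conductor `p^{n+1+e₀}` has a NON-zero Birch sum. Then for EVERY `n ∉ S₀`
  every such Birch sum of conductor `p^{n+1+e₀}` is non-zero (either the budget forbids the layer —
  `add_sum_totient_le_lam_of_ratTwistedSymbolSum_eq_zero` with `S₀ ∪ {n}` — or the check plus the
  Galois-orbit theorem `ratTwistedSymbolSum_eq_zero_iff_of_level_eq` does).
* `forall_twistedLValue_ne_zero_of_budget`: the complex side, `L(E, χ, 1) ≠ 0` at every conductor
  outside `S₀` (gen-6 transport, Birch proved in the tree).
* `ordinary_forall_twistedLValue_ne_zero_of_budget` (good ordinary `p`, `L_p(E,T)`, `α = unitRoot`,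
  `α ≠ 0` by `norm_unitRoot_holds`; `r = 1` available from `ord_{s=1}L(E,s) ≠ 0`),
  `ordinary_exists_nsmul_mem_range_baseChange_layer_of_checked_of_kato` (`S₀ = ∅`: granted `hK`, no
  rank growth anywhere in the tower), and the signed (`a_p = 0`) form
  `signed_forall_ratTwistedSymbolSum_ne_zero_of_budget` for Kobayashi's `L_p^ε` (parity-`ε` layers).

References: [Washington1997] §7.1–7.2; [MazurTateTeitelbaum1986Invent] §I.8 (8.6), §I.13–I.14;
[Kobayashi2003] Thm. 3.2; HOME/b2b-bsdres-additive-p3/X8-ROUTE-B.md §13 (gen 8).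
-/

set_option autoImplicit false

noncomputable section

open scoped Classical MatrixGroups ModularForm

open CongruenceSubgroup Polynomial WeierstrassCurve Literature.NumberTheory.EllipticCurves
  Literature.NumberTheory.EllipticCurves.ModularForms
  Literature.NumberTheory.EllipticCurves.GreenbergVatsal2000
  Literature.NumberTheory.EllipticCurves.Kobayashi2003
  Summit.BirchSwinnertonDyer.Rank1Residual.X1.MuLambda
  Summit.BirchSwinnertonDyer.Rank1Residual.X11a
  Summit.BirchSwinnertonDyer.Rank1Residual.Supersingular

namespace Summit.BirchSwinnertonDyer.Rank1Residual.Iwasawa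

variable {p : ℕ} [hp : Fact p.Prime] {N : ℕ} {f : CuspForm (Gamma0 N) 2}

/-! ## §1. `p`-adic side: the budget theorem -/

section Budget

/-- **Budget theorem (`p`-adic side).** `hI` the twisted interpolation clause for `(f, α)`, `α ≠ 0`,
`ι(G) = ϖ·L`, `T^r ∣ G ≠ 0`; `S₀` a finite set of layers each with a vanishing Birch sum of
conductor `p^{m+1+e₀}`; `hcheck`: every layer `n ∉ S₀` that still fits the budget
(`r + Σ_{m∈S₀} φ(p^{m+1}) + φ(pⁿ⁺¹) ≤ λ(G)`) has SOME non-vanishing Birch sum. Then every primitive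
even `p`-power-order Birch sum of every conductor `p^{n+1+e₀}`, `n ∉ S₀`, is non-zero.
[cite: MazurTateTeitelbaum1986Invent, §I.13–I.14] [cite: Washington1997, §7.1–7.2 and Thm. 7.3] -/
theorem forall_ratTwistedSymbolSum_ne_zero_of_budget {α : ℚ_[p]} (hα : α ≠ 0) {L : PowerSeries ℚ_[p]}
    (hI : ∀ (m : ℕ), 0 < m → ∀ χ : DirichletCharacter ℂ_[p] (p ^ m), χ.IsPrimitive → χ.Even →
      (∃ j : ℕ, orderOf χ = p ^ j) →
        HasSum (fun k : ℕ ↦ algebraMap ℚ_[p] ℂ_[p] (PowerSeries.coeff k L) *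
            (χ (cyclotomicGenerator p : ZMod (p ^ m)) - 1) ^ k)
          (algebraMap ℚ_[p] ℂ_[p] (α⁻¹ ^ m) * ratTwistedSymbolSum f χ))
    {G : IwasawaAlgebra p} {ϖ : ℚ_[p]} (hG : iwasawaToPowerSeries p G = PowerSeries.C ϖ * L)
    (hG0 : G ≠ 0) {r : ℕ} (hX : (PowerSeries.X : IwasawaAlgebra p) ^ r ∣ G) (S₀ : Finset ℕ)
    (hS₀ : ∀ m ∈ S₀, ∃ χ : DirichletCharacter ℂ_[p] (p ^ (m + 1 + cyclotomicExponent p)),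
      χ.IsPrimitive ∧ χ.Even ∧ (∃ j : ℕ, orderOf χ = p ^ j) ∧ ratTwistedSymbolSum f χ = 0)
    (hcheck : ∀ n ∉ S₀, r + ∑ m ∈ S₀, Nat.totient (p ^ (m + 1)) + Nat.totient (p ^ (n + 1)) ≤ lam G →
      ∃ χ₀ : DirichletCharacter ℂ_[p] (p ^ (n + 1 + cyclotomicExponent p)),
        χ₀.IsPrimitive ∧ χ₀.Even ∧ (∃ j : ℕ, orderOf χ₀ = p ^ j) ∧ ratTwistedSymbolSum f χ₀ ≠ 0)
    {n : ℕ} (hn : n ∉ S₀) (χ : DirichletCharacter ℂ_[p] (p ^ (n + 1 + cyclotomicExponent p)))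
    (hχ : χ.IsPrimitive) (hev : χ.Even) (hord : ∃ j : ℕ, orderOf χ = p ^ j) :
    ratTwistedSymbolSum f χ ≠ 0 := by
  intro h0
  by_cases hfit : r + ∑ m ∈ S₀, Nat.totient (p ^ (m + 1)) + Nat.totient (p ^ (n + 1)) ≤ lam G
  · -- the budget can afford layer `n`: the check gives a non-vanishing `χ₀`, contradicting the orbit
    obtain ⟨χ₀, hχ₀, hev₀, hord₀, hne⟩ := hcheck n hn hfit
    exact hne ((ratTwistedSymbolSum_eq_zero_iff_of_level_eq hα hI hG hG0 hχ hev hord hχ₀ hev₀ hord₀).mp h0)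
  · -- the budget cannot afford layer `n`: `S₀ ∪ {n}` would violate the accounting
    have hle := add_sum_totient_le_lam_of_ratTwistedSymbolSum_eq_zero hI hG hG0 hX (insert n S₀)
      (fun m hm ↦ by
        rcases Finset.mem_insert.mp hm with rfl | hm'
        · exact ⟨χ, hχ, hev, hord, h0⟩
        · exact hS₀ m hm')
    rw [Finset.sum_insert hn] at hle
    exact hfit (by omega)

/-- **Checked form (`S₀ = ∅`)**: if every layer `n` with `r + φ(pⁿ⁺¹) ≤ λ(G)` has some non-vanishing
Birch sum of conductor `p^{n+1+e₀}`, then ALL primitive even `p`-power-order Birch sums of ALL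
conductors are non-zero. [cite: MazurTateTeitelbaum1986Invent, §I.13–I.14] [cite: Washington1997, §7.1–7.2 and Thm. 7.3] -/
theorem forall_ratTwistedSymbolSum_ne_zero_of_checked {α : ℚ_[p]} (hα : α ≠ 0) {L : PowerSeries ℚ_[p]}
    (hI : ∀ (m : ℕ), 0 < m → ∀ χ : DirichletCharacter ℂ_[p] (p ^ m), χ.IsPrimitive → χ.Even →
      (∃ j : ℕ, orderOf χ = p ^ j) →
        HasSum (fun k : ℕ ↦ algebraMap ℚ_[p] ℂ_[p] (PowerSeries.coeff k L) *
            (χ (cyclotomicGenerator p : ZMod (p ^ m)) - 1) ^ k)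
          (algebraMap ℚ_[p] ℂ_[p] (α⁻¹ ^ m) * ratTwistedSymbolSum f χ))
    {G : IwasawaAlgebra p} {ϖ : ℚ_[p]} (hG : iwasawaToPowerSeries p G = PowerSeries.C ϖ * L)
    (hG0 : G ≠ 0) {r : ℕ} (hX : (PowerSeries.X : IwasawaAlgebra p) ^ r ∣ G)
    (hcheck : ∀ n : ℕ, r + Nat.totient (p ^ (n + 1)) ≤ lam G →
      ∃ χ₀ : DirichletCharacter ℂ_[p] (p ^ (n + 1 + cyclotomicExponent p)),
        χ₀.IsPrimitive ∧ χ₀.Even ∧ (∃ j : ℕ, orderOf χ₀ = p ^ j) ∧ ratTwistedSymbolSum f χ₀ ≠ 0)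
    {n : ℕ} (χ : DirichletCharacter ℂ_[p] (p ^ (n + 1 + cyclotomicExponent p))) (hχ : χ.IsPrimitive)
    (hev : χ.Even) (hord : ∃ j : ℕ, orderOf χ = p ^ j) : ratTwistedSymbolSum f χ ≠ 0 :=
  forall_ratTwistedSymbolSum_ne_zero_of_budget hα hI hG hG0 hX ∅ (fun _ hm ↦ absurd hm (Finset.notMem_empty _))
    (fun m _ hfit ↦ hcheck m (by simpa using hfit)) (Finset.notMem_empty n) χ hχ hev hord

end Budget

/-! ## §2. Complex side and instances -/

section Complex

variable [NeZero N] {W : WeierstrassCurve ℚ} [W.IsElliptic] [W.IsGloballyMinimal]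

omit [W.IsElliptic] [W.IsGloballyMinimal] in
/-- **Budget theorem, complex side**: under the hypotheses of
`forall_ratTwistedSymbolSum_ne_zero_of_budget` (with `f` the newform of `E = W`), for every layer
`n ∉ S₀`, every primitive even `p`-power-order Dirichlet character `χ` of conductor `p^{n+1+e₀}` and
every entire continuation `L_χ` of `L(E, χ, s)`: `L_χ(1) ≠ 0`.
[cite: MazurTateTeitelbaum1986Invent, §I.8 (8.6) and §I.13–I.14] [cite: Washington1997, §7.1–7.2 and Thm. 7.3] -/
theorem forall_twistedLValue_ne_zero_of_budget (hf : IsNewformOf W f) {α : ℚ_[p]} (hα : α ≠ 0)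
    {L : PowerSeries ℚ_[p]}
    (hI : ∀ (m : ℕ), 0 < m → ∀ χ : DirichletCharacter ℂ_[p] (p ^ m), χ.IsPrimitive → χ.Even →
      (∃ j : ℕ, orderOf χ = p ^ j) →
        HasSum (fun k : ℕ ↦ algebraMap ℚ_[p] ℂ_[p] (PowerSeries.coeff k L) *
            (χ (cyclotomicGenerator p : ZMod (p ^ m)) - 1) ^ k)
          (algebraMap ℚ_[p] ℂ_[p] (α⁻¹ ^ m) * ratTwistedSymbolSum f χ))
    {G : IwasawaAlgebra p} {ϖ : ℚ_[p]} (hG : iwasawaToPowerSeries p G = PowerSeries.C ϖ * L)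
    (hG0 : G ≠ 0) {r : ℕ} (hX : (PowerSeries.X : IwasawaAlgebra p) ^ r ∣ G) (S₀ : Finset ℕ)
    (hS₀ : ∀ m ∈ S₀, ∃ χ : DirichletCharacter ℂ_[p] (p ^ (m + 1 + cyclotomicExponent p)),
      χ.IsPrimitive ∧ χ.Even ∧ (∃ j : ℕ, orderOf χ = p ^ j) ∧ ratTwistedSymbolSum f χ = 0)
    (hcheck : ∀ n ∉ S₀, r + ∑ m ∈ S₀, Nat.totient (p ^ (m + 1)) + Nat.totient (p ^ (n + 1)) ≤ lam G →
      ∃ χ₀ : DirichletCharacter ℂ_[p] (p ^ (n + 1 + cyclotomicExponent p)),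
        χ₀.IsPrimitive ∧ χ₀.Even ∧ (∃ j : ℕ, orderOf χ₀ = p ^ j) ∧ ratTwistedSymbolSum f χ₀ ≠ 0)
    {n : ℕ} (hn : n ∉ S₀) (χ : DirichletCharacter ℂ (p ^ (n + 1 + cyclotomicExponent p)))
    (hχ : χ.IsPrimitive) (hev : χ.Even) (hord : ∃ j : ℕ, orderOf χ = p ^ j) {Lχ : ℂ → ℂ}
    (hLd : Differentiable ℂ Lχ) (hLχ : ∀ s : ℂ, 2 < s.re → Lχ s = twistedLSeries f χ s) : Lχ 1 ≠ 0 := by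
  haveI : NeZero (p ^ (n + 1 + cyclotomicExponent p)) := ⟨pow_ne_zero _ hp.out.ne_zero⟩
  exact forall_twistedLValue_ne_zero_of_padic (f := f) hf
    (fun χ' hχ' hev' hord' ↦ forall_ratTwistedSymbolSum_ne_zero_of_budget hα hI hG hG0 hX S₀ hS₀ hcheck hn
      χ' hχ' hev' hord') χ hχ hev hord hLd hLχ

/-- **Good ordinary `p`: the budget theorem for `L_p(E,T) = padicLFunction f (unitRoot W p)`**
(interpolation = tree theorem `isPAdicLFunctionOf_padicLFunction_holds`; `α = unitRoot W p ≠ 0` by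
`norm_unitRoot_holds`); `G` any integral model, `T^r ∣ G` (e.g. `r = 1` from
`ordinary_X_dvd_of_entireLFunction_one_eq_zero` when `L(E,1) = 0`). For `n ∉ S₀`: `L(E, χ, 1) ≠ 0` at
conductor `p^{n+1+e₀}`. [cite: MazurSwinnertonDyer1974Invent, §9] [cite: MazurTateTeitelbaum1986Invent, §I.14 (14.3)] -/
theorem ordinary_forall_twistedLValue_ne_zero_of_budget (hord : IsOrdinaryAt W p)
    (hf : IsNewformOf W f) {G : IwasawaAlgebra p} {ϖ : ℚ_[p]}
    (hG : iwasawaToPowerSeries p G = PowerSeries.C ϖ * padicLFunction f (unitRoot W p : ℚ_[p]))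
    (hG0 : G ≠ 0) {r : ℕ} (hX : (PowerSeries.X : IwasawaAlgebra p) ^ r ∣ G) (S₀ : Finset ℕ)
    (hS₀ : ∀ m ∈ S₀, ∃ χ : DirichletCharacter ℂ_[p] (p ^ (m + 1 + cyclotomicExponent p)),
      χ.IsPrimitive ∧ χ.Even ∧ (∃ j : ℕ, orderOf χ = p ^ j) ∧ ratTwistedSymbolSum f χ = 0)
    (hcheck : ∀ n ∉ S₀, r + ∑ m ∈ S₀, Nat.totient (p ^ (m + 1)) + Nat.totient (p ^ (n + 1)) ≤ lam G →
      ∃ χ₀ : DirichletCharacter ℂ_[p] (p ^ (n + 1 + cyclotomicExponent p)),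
        χ₀.IsPrimitive ∧ χ₀.Even ∧ (∃ j : ℕ, orderOf χ₀ = p ^ j) ∧ ratTwistedSymbolSum f χ₀ ≠ 0)
    {n : ℕ} (hn : n ∉ S₀) (χ : DirichletCharacter ℂ (p ^ (n + 1 + cyclotomicExponent p)))
    (hχ : χ.IsPrimitive) (hev : χ.Even) (hordχ : ∃ j : ℕ, orderOf χ = p ^ j) {Lχ : ℂ → ℂ}
    (hLd : Differentiable ℂ Lχ) (hLχ : ∀ s : ℂ, 2 < s.re → Lχ s = twistedLSeries f χ s) : Lχ 1 ≠ 0 := by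
  have hα : (unitRoot W p : ℚ_[p]) ≠ 0 := by
    intro h0
    have h1 := norm_unitRoot_holds W p hord
    rw [h0, norm_zero] at h1
    exact zero_ne_one h1
  exact forall_twistedLValue_ne_zero_of_budget hf hα (isPAdicLFunctionOf_padicLFunction_holds hord hf).2 hG
    hG0 hX S₀ hS₀ hcheck hn χ hχ hev hordχ hLd hLχ

set_option backward.isDefEq.respectTransparency false in
/-- **Good ordinary `p`, checked form (`S₀ = ∅`), tower**: if every layer the budget `λ(G) − r` can
afford carries a non-vanishing Birch sum, then (granted Kato's Cor. 14.3 (2), `p ≠ 2`) every point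
of `E(ℚ_n)` has a positive multiple coming from `E(ℚ)`, for every layer `ℚ_n` of the cyclotomic
`ℤ_p`-tower. [cite: Kato2004Asterisque, Cor. 14.3 (2) (p. 235) and Thm. 14.4 (p. 236)]
[cite: MazurTateTeitelbaum1986Invent, §I.14 (14.3)] -/
theorem ordinary_exists_nsmul_mem_range_baseChange_layer_of_checked_of_kato
    (hK : kato_finite_chiPart_of_twistedLValue_ne_zero) (hp2 : p ≠ 2) (hord : IsOrdinaryAt W p)
    (hf : IsNewformOf W f) {G : IwasawaAlgebra p} {ϖ : ℚ_[p]}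
    (hG : iwasawaToPowerSeries p G = PowerSeries.C ϖ * padicLFunction f (unitRoot W p : ℚ_[p]))
    (hG0 : G ≠ 0) {r : ℕ} (hX : (PowerSeries.X : IwasawaAlgebra p) ^ r ∣ G)
    (hcheck : ∀ n : ℕ, r + Nat.totient (p ^ (n + 1)) ≤ lam G →
      ∃ χ₀ : DirichletCharacter ℂ_[p] (p ^ (n + 1 + cyclotomicExponent p)),
        χ₀.IsPrimitive ∧ χ₀.Even ∧ (∃ j : ℕ, orderOf χ₀ = p ^ j) ∧ ratTwistedSymbolSum f χ₀ ≠ 0)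
    {n : ℕ} [NeZero (p ^ (n + cyclotomicExponent p))]
    [DecidableEq (CyclotomicField (p ^ (n + cyclotomicExponent p)) ℚ)]
    {P : (W.baseChange (CyclotomicField (p ^ (n + cyclotomicExponent p)) ℚ)).toAffine.Point}
    (hP : ∀ σ : CyclotomicField (p ^ (n + cyclotomicExponent p)) ℚ ≃ₐ[ℚ]
        CyclotomicField (p ^ (n + cyclotomicExponent p)) ℚ,
      (∃ w : rootsOfUnity (torsionOrder p) ℤ_[p],
        IsCyclotomicExtension.autEquivPow (CyclotomicField (p ^ (n + cyclotomicExponent p)) ℚ)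
            (cyclotomic.irreducible_rat (NeZero.pos (p ^ (n + cyclotomicExponent p)))) σ =
          Units.map (PadicInt.toZModPow (n + cyclotomicExponent p)).toMonoidHom (w : ℤ_[p]ˣ)) →
      Affine.Point.map (W' := W.toAffine)
        (σ : CyclotomicField (p ^ (n + cyclotomicExponent p)) ℚ →ₐ[ℚ]
          CyclotomicField (p ^ (n + cyclotomicExponent p)) ℚ) P = P) :
    ∃ m : ℕ, 0 < m ∧ m • P ∈ Set.range
      (Affine.Point.baseChange (W' := W.toAffine) ℚ
        (CyclotomicField (p ^ (n + cyclotomicExponent p)) ℚ)) := by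
  have hα : (unitRoot W p : ℚ_[p]) ≠ 0 := by
    intro h0
    have h1 := norm_unitRoot_holds W p hord
    rw [h0, norm_zero] at h1
    exact zero_ne_one h1
  refine exists_nsmul_mem_range_baseChange_layer_of_kato hK hp2 hf (fun k hk _ χ hχ hev hordχ _ hLd hLχ ↦ ?_) hP
  obtain ⟨k, rfl⟩ := Nat.exists_eq_succ_of_ne_zero hk.ne'
  haveI : NeZero (p ^ (k + 1 + cyclotomicExponent p)) := ⟨pow_ne_zero _ hp.out.ne_zero⟩
  exact forall_twistedLValue_ne_zero_of_padic (f := f) hf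
    (fun χ' hχ' hev' hord' ↦ forall_ratTwistedSymbolSum_ne_zero_of_checked hα
      (isPAdicLFunctionOf_padicLFunction_holds hord hf).2 hG hG0 hX hcheck χ' hχ' hev' hord')
    χ hχ hev hordχ hLd hLχ

end Complex

/-! ## §3. Signed form (`a_p = 0`): Kobayashi's `L_p^ε`, parity-`ε` layers -/

section Signed

/-- **Signed budget theorem** for `L_p^ε` (`IsSignedPAdicLFunction f p ε L`, `L ≠ 0`, `T^r ∣ L`):
`S₀` a finite set of parity-`ε` levels `k + 1` each with a vanishing Birch sum of conductor
`p^{k+1+e₀}`; if every further parity-`ε` level `k + 1`, `k ∉ S₀`, that fits the budget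
(`r + Σ_{m∈S₀} φ(p^{m+1}) + φ(p^{k+1}) ≤ λ(L)`) has some non-vanishing Birch sum, then every primitive
even `p`-power-order Birch sum of every parity-`ε` conductor outside `S₀` is non-zero. No `μ`
hypothesis. [cite: Kobayashi2003, Thm. 3.2 and (3.4)–(3.5) (p. 7)] [cite: Washington1997, §7.1–7.2 and Thm. 7.3] -/
theorem signed_forall_ratTwistedSymbolSum_ne_zero_of_budget {ε : ℤˣ} {L : IwasawaAlgebra p}
    (hL : IsSignedPAdicLFunction f p ε L) (hL0 : L ≠ 0) {r : ℕ}
    (hX : (PowerSeries.X : IwasawaAlgebra p) ^ r ∣ L) (S₀ : Finset ℕ)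
    (hS₀ : ∀ m ∈ S₀, (Even (m + 1) ↔ ε = 1) ∧
      ∃ χ : DirichletCharacter ℂ_[p] (p ^ (m + 1 + cyclotomicExponent p)),
        χ.IsPrimitive ∧ χ.Even ∧ (∃ j : ℕ, orderOf χ = p ^ j) ∧ ratTwistedSymbolSum f χ = 0)
    (hcheck : ∀ k ∉ S₀, (Even (k + 1) ↔ ε = 1) →
      r + ∑ m ∈ S₀, Nat.totient (p ^ (m + 1)) + Nat.totient (p ^ (k + 1)) ≤ lam L →
        ∃ χ₀ : DirichletCharacter ℂ_[p] (p ^ (k + 1 + cyclotomicExponent p)),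
          χ₀.IsPrimitive ∧ χ₀.Even ∧ (∃ j : ℕ, orderOf χ₀ = p ^ j) ∧ ratTwistedSymbolSum f χ₀ ≠ 0)
    {k : ℕ} (hk : k ∉ S₀) (hpar : Even (k + 1) ↔ ε = 1)
    (χ : DirichletCharacter ℂ_[p] (p ^ (k + 1 + cyclotomicExponent p))) (hχ : χ.IsPrimitive)
    (hev : χ.Even) (hord : ∃ j : ℕ, orderOf χ = p ^ j) : ratTwistedSymbolSum f χ ≠ 0 := by
  intro h0
  by_cases hfit : r + ∑ m ∈ S₀, Nat.totient (p ^ (m + 1)) + Nat.totient (p ^ (k + 1)) ≤ lam L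
  · obtain ⟨χ₀, hχ₀, hev₀, hord₀, hne⟩ := hcheck k hk hpar hfit
    exact hne ((signed_ratTwistedSymbolSum_eq_zero_iff_of_level_eq hL hpar hχ hev hord hχ₀ hev₀ hord₀).mp h0)
  · have hle := signed_add_sum_totient_le_lam hL hL0 hX (insert k S₀) (fun m hm ↦ by
      rcases Finset.mem_insert.mp hm with rfl | hm'
      · exact ⟨hpar, χ, hχ, hev, hord, h0⟩
      · exact hS₀ m hm')
    rw [Finset.sum_insert hk] at hle
    exact hfit (by omega)

end Signed

end Summit.BirchSwinnertonDyer.Rank1Residual.Iwasawa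

end
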